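import Summits.NavierStokesRegularity.NavierStokesRegularity.Theses.RellichScar
import Summits.NavierStokesRegularity.NavierStokesRegularity.Theorems.SymmetricScarExists.Negative.SpiralWorld
import Summits.NavierStokesRegularity.NavierStokesRegularity.Theorems.SymmetricScarExists.Negative.TargetCostume
import Summits.NavierStokesRegularity.NavierStokesRegularity.Theorems.ScarRigidity.Negative.LogicAndLoadBearing
import Summits.NavierStokesRegularity.NavierStokesRegularity.Theorems.RellichScarSimilarityCovariance
import Summits.NavierStokesRegularity.NavierStokesRegularity.Theorems.RellichScarSelfSimilarApexFatal
import Summits.NavierStokesRegularity.NavierStokesRegularity.Theorems.RellichScarAxisymmetricApexFatal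
import Summits.NavierStokesRegularity.NavierStokesRegularity.Theorems.RellichScarSymmetricScarExistsApexScarTrace
import Summits.NavierStokesRegularity.NavierStokesRegularity.Theorems.RellichScarSymmetricScarExistsLimitRepresentative
import Summits.NavierStokesRegularity.NavierStokesRegularity.Theorems.RellichScarSymmetricScarExistsSlabLimit
import Summits.NavierStokesRegularity.NavierStokesRegularity.Theorems.RellichScarSymmetricScarExistsScarDefectLimit
import Summits.NavierStokesRegularity.NavierStokesRegularity.Theorems.RellichScarSymmetricScarExistsScaleWindowRigidity
import Summits.NavierStokesRegularity.NavierStokesRegularity.Theorems.RellichScarSymmetricScarExistsRotWindowRigidity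
import Literature.Analysis.FluidPDE.LocalTypeI
import Literature.Analysis.FluidPDE.TypeIAncientMild

/-!
# Crux `SymmetricScarExists` (stmt-NavierStokesRegularity-11718), line `analytic-scar-window-rigidity`:
# the TRANSFER theorem — the crux follows from, and is equivalent to, its ε-flat-family form

Helper file of the line lead (`--supports stmt-NavierStokesRegularity-11718`; theorems only, no definitions, no
named facts).  The line's reshaped skeleton (`Cruxes/SymmetricScarExists/Lines/analytic_scar_window_rigidity.lean`)
reduces the crux to ONE bet, `stub_flatSource`: *if a singular apex Type-I profile exists, then for some constant
`C'`, bound `I < ∞` and non-trivial window `[a, b]` there is a SEQUENCE of singular apex profiles (`𝐈 ≤ I`, decay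
`C'`) along which either the homogeneity defect of the scar at every scale `λ ∈ [a, b]` (`0 < a`) or the
axisymmetry defect at every angle `θ ∈ [a, b]` tends to zero, essentially near the final slice, on every compact
`K ∌ 0`*.  All six known-mathematics stubs of the skeleton are landed theorems
(`Theorems/RellichScarSymmetricScarExists{ApexScarTrace,LimitRepresentative,SlabLimit,ScarDefectLimit,ScaleWindowRigidity,RotWindowRigidity}.lean`),
so the composition is a theorem of the tree, recorded here:

* `symmetricScarExists_of_flatSource` — **bet ⇒ crux** (registered auxiliary stub of the same name): the bet's
  sequence, its decay constant bumped to `|C'| + 1 > 0`, subconverges to a singular apex profile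
  (`stub_slabLimit` = Albritton–Barker Lemma 2.2 + Prop. 2.3 on the slab); along the subsequence the scar
  defects still tend to zero, so the limit's scar is flat on the whole window (`stub_scarDefectLimit`, fed with
  `stub_apexScarTrace` and `stub_limitRepresentative`); window rigidity (`stub_scaleWindowRigidity`,
  `stub_rotWindowRigidity`) makes it (−1)-homogeneous, resp. axisymmetric.
* `flatSource_of_symmetricScarExists` — **crux ⇒ bet** (the constant sequence on the symmetric-scar profile).
* `flatSource_iff_symmetricScarExists` — hence the bet is an EQUIVALENT, compactness-upgraded form of the
  crux: to prove `SymmetricScarExists` it suffices to produce APPROXIMATELY symmetric scars along any sequence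
  of singular apex profiles with bounded `𝐈` and a common Type-I constant.
* `flatSource_iff_noApexTypeIProfile` — calibration (Disproof §8 for the bet): granted the sibling crux
  `ScarRigidity` (the three supports `SimilarityCovariance`, `SelfSimilarApexFatal`, `AxisymmetricApexFatal`
  being PROVED tree theorems), the bet is equivalent to the route target `NoApexTypeIProfile`.

References: D. Albritton, T. Barker, J. Math. Fluid Mech. 21 (2019) = arXiv:1811.00502, Lemma 2.2, Prop. 2.3
[AlbrittonBarker2019]; G. Koch, N. Nadirashvili, G. Seregin, V. Šverák, Acta Math. 203 (2009), (1.6), Prop. 4.1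
[KNSS2009]; T.-P. Tsai, ARMA 143 (1998), Thm 2 [Tsai1998]; G. Seregin, V. Šverák, Comm. PDE 34 (2009), Thm 3.1
[SereginSverak2009].
-/

noncomputable section

open MeasureTheory Set Function Filter Topology TopologicalSpace Metric
open scoped NNReal ENNReal

namespace Summit.NavierStokesRegularity.NavierStokesRegularity.Theorems.SymmetricScarExists.ScarWindow

open Literature.Analysis.FluidPDE
open Summit.NavierStokesRegularity.NavierStokesRegularity.Theses.RellichScar
open Summit.NavierStokesRegularity.NavierStokesRegularity.Theorems.SymmetricScarExists.Negative
open Summit.NavierStokesRegularity.NavierStokesRegularity.Theorems.ScarRigidity.Negative (hasTypeIDecay_mono)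

set_option linter.dupNamespace false

/-- Eventual statements along `atTop` pass to subsequences. [folklore] -/
theorem eventually_comp_of_strictMono' {P : ℕ → Prop} {φ : ℕ → ℕ} (hφ : StrictMono φ)
    (h : ∀ᶠ k in atTop, P k) : ∀ᶠ j in atTop, P (φ j) :=
  hφ.tendsto_atTop.eventually h

/-- A scar functional tending to zero is eventually below every positive level. [folklore] -/
theorem eventually_le_ofReal_of_tendsto_zero {f : ℝ → ℝ≥0∞} {l : Filter ℝ}
    (h : Tendsto f l (𝓝 0)) {ε : ℝ} (hε : 0 < ε) : ∀ᶠ δ in l, f δ ≤ ENNReal.ofReal ε :=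
  ((tendsto_order.1 h).2 (ENNReal.ofReal ε) (ENNReal.ofReal_pos.2 hε)).mono fun _ hδ => hδ.le

/-- **Bet ⇒ crux** (registered auxiliary stub `symmetricScarExists_of_flatSource` of the line
`analytic-scar-window-rigidity`): the ε-flat-family form of the crux implies `SymmetricScarExists` BY NAME.
The bet's sequence (decay constant bumped to `|C'| + 1 > 0`) subconverges to a singular apex profile
(`stub_slabLimit`); along the subsequence the scar defects still tend to zero, so the limit's scar is flat on the
whole window (`stub_scarDefectLimit` with `stub_apexScarTrace`, `stub_limitRepresentative`); window rigidity
(`stub_scaleWindowRigidity` / `stub_rotWindowRigidity`) makes it (−1)-homogeneous, resp. axisymmetric.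
[cite: AlbrittonBarker2019, Lemma 2.2 and Prop. 2.3] -/
theorem symmetricScarExists_of_flatSource :
    (∀ C : ℝ, (∃ (u : ℝ → EuclideanSpace ℝ (Fin 3) → EuclideanSpace ℝ (Fin 3)) (p : ℝ → EuclideanSpace ℝ (Fin 3) → ℝ) (G : ℝ → EuclideanSpace ℝ (Fin 3) → EuclideanSpace ℝ (Fin 3) →L[ℝ] EuclideanSpace ℝ (Fin 3)), IsSuitableWeakSolutionOn (slab (EuclideanSpace ℝ (Fin 3)) (Iio (0 : ℝ)) isOpen_Iio) 1 0 u p ∧ HasWeakSpatialGradientOn (slab (EuclideanSpace ℝ (Fin 3)) (Iio (0 : ℝ)) isOpen_Iio) u G ∧ typeIBound (Iio (0 : ℝ) ×ˢ univ) u p G < ⊤ ∧ HasTypeIDecay C u ∧ IsBackwardSingularPoint u 0) →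
      ∃ (C' : ℝ) (I : ℝ≥0∞) (a b : ℝ) (v : ℕ → ℝ → EuclideanSpace ℝ (Fin 3) → EuclideanSpace ℝ (Fin 3)) (q : ℕ → ℝ → EuclideanSpace ℝ (Fin 3) → ℝ) (H : ℕ → ℝ → EuclideanSpace ℝ (Fin 3) → EuclideanSpace ℝ (Fin 3) →L[ℝ] EuclideanSpace ℝ (Fin 3)),
        I < ⊤ ∧ a < b ∧
        (∀ k : ℕ, IsSuitableWeakSolutionOn (slab (EuclideanSpace ℝ (Fin 3)) (Iio (0 : ℝ)) isOpen_Iio) 1 0 (v k) (q k) ∧ HasWeakSpatialGradientOn (slab (EuclideanSpace ℝ (Fin 3)) (Iio (0 : ℝ)) isOpen_Iio) (v k) (H k) ∧ typeIBound (Iio (0 : ℝ) ×ˢ univ) (v k) (q k) (H k) ≤ I ∧ HasTypeIDecay C' (v k) ∧ IsBackwardSingularPoint (v k) 0) ∧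
        ((0 < a ∧ ∀ lam ∈ Icc a b, ∀ K : Set (EuclideanSpace ℝ (Fin 3)), IsCompact K → (0 : EuclideanSpace ℝ (Fin 3)) ∉ K → ∀ ε : ℝ, 0 < ε → ∀ᶠ k in atTop, ∀ᶠ δ in 𝓝[>] (0 : ℝ), eLpNorm (uncurry (nsRescale lam (v k)) - uncurry (v k)) ⊤ (volume.restrict (Ioo (-δ) 0 ×ˢ K)) ≤ ENNReal.ofReal ε) ∨
         (∀ θ ∈ Icc a b, ∀ K : Set (EuclideanSpace ℝ (Fin 3)), IsCompact K → (0 : EuclideanSpace ℝ (Fin 3)) ∉ K → ∀ ε : ℝ, 0 < ε → ∀ᶠ k in atTop, ∀ᶠ δ in 𝓝[>] (0 : ℝ), eLpNorm (uncurry (conjZ θ (v k)) - uncurry (v k)) ⊤ (volume.restrict (Ioo (-δ) 0 ×ˢ K)) ≤ ENNReal.ofReal ε))) →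
    SymmetricScarExists := by
  intro hbet
  rw [symmetricScarExists_iff_homScar_or_axiScar]
  intro C hex
  obtain ⟨C', I, a, b, v, q, H, hI, hab, hfam, hflat⟩ := hbet C hex
  -- bump the decay constant to a positive one
  set C₁ : ℝ := |C'| + 1 with hC₁
  have hC₁pos : 0 < C₁ := by positivity
  have hCC : C' ≤ C₁ := (le_abs_self C').trans (by linarith)
  have hfam₁ : ∀ k : ℕ, IsSuitableWeakSolutionOn (slab (EuclideanSpace ℝ (Fin 3)) (Iio (0 : ℝ)) isOpen_Iio) 1 0 (v k) (q k) ∧ HasWeakSpatialGradientOn (slab (EuclideanSpace ℝ (Fin 3)) (Iio (0 : ℝ)) isOpen_Iio) (v k) (H k) ∧ typeIBound (Iio (0 : ℝ) ×ˢ univ) (v k) (q k) (H k) ≤ I ∧ HasTypeIDecay C₁ (v k) ∧ IsBackwardSingularPoint (v k) 0 :=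
    fun k => ⟨(hfam k).1, (hfam k).2.1, (hfam k).2.2.1, hasTypeIDecay_mono hCC (hfam k).2.2.2.1, (hfam k).2.2.2.2⟩
  -- compactness: a singular apex limit along a subsequence
  obtain ⟨u, p, G, φ, hφ, hsu, hwg, hIu, hdu, hsing, hconv⟩ := stub_slabLimit C₁ I v q H hC₁pos.le hI hfam₁
  -- the subsequence, still in the class, still converging
  have hw : ∀ j : ℕ, IsSuitableWeakSolutionOn (slab (EuclideanSpace ℝ (Fin 3)) (Iio (0 : ℝ)) isOpen_Iio) 1 0 (v (φ j)) (q (φ j)) ∧ HasWeakSpatialGradientOn (slab (EuclideanSpace ℝ (Fin 3)) (Iio (0 : ℝ)) isOpen_Iio) (v (φ j)) (H (φ j)) ∧ typeIBound (Iio (0 : ℝ) ×ˢ univ) (v (φ j)) (q (φ j)) (H (φ j)) < ⊤ ∧ HasTypeIDecay C₁ (v (φ j)) :=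
    fun j => ⟨(hfam₁ (φ j)).1, (hfam₁ (φ j)).2.1, lt_of_le_of_lt (hfam₁ (φ j)).2.2.1 hI, (hfam₁ (φ j)).2.2.2.1⟩
  obtain ⟨hscale, hrot⟩ := stub_scarDefectLimit stub_apexScarTrace stub_limitRepresentative C₁
    (fun j => v (φ j)) (fun j => q (φ j)) (fun j => H (φ j)) u p G hC₁pos hw hsu hwg hIu hdu hconv
  refine ⟨C₁, u, p, G, hsu, hwg, hIu, hdu, hsing, ?_⟩
  rcases hflat with ⟨ha, hwin⟩ | hwin
  · -- scale-flat window ⇒ homogeneous scar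
    left
    refine stub_scaleWindowRigidity u a b ha hab fun lam hlam => ?_
    refine hscale lam (ha.trans_le hlam.1) fun K hK h0 ε hε => ?_
    exact eventually_comp_of_strictMono' hφ (hwin lam hlam K hK h0 ε hε)
  · -- rotation-flat window ⇒ axisymmetric scar
    right
    refine stub_rotWindowRigidity u a b hab fun θ hθ => ?_
    refine hrot θ fun K hK h0 ε hε => ?_
    exact eventually_comp_of_strictMono' hφ (hwin θ hθ K hK h0 ε hε)

/-- **Crux ⇒ bet**: a singular apex profile with a (−1)-homogeneous, resp. axisymmetric, scar furnishes the
constant sequence, flat at every scale in `[1, 2]`, resp. every angle in `[1, 2]`, with `I` its own `𝐈`. [folklore] -/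
theorem flatSource_of_symmetricScarExists (hS : SymmetricScarExists) :
    ∀ C : ℝ, (∃ (u : ℝ → EuclideanSpace ℝ (Fin 3) → EuclideanSpace ℝ (Fin 3)) (p : ℝ → EuclideanSpace ℝ (Fin 3) → ℝ) (G : ℝ → EuclideanSpace ℝ (Fin 3) → EuclideanSpace ℝ (Fin 3) →L[ℝ] EuclideanSpace ℝ (Fin 3)), IsSuitableWeakSolutionOn (slab (EuclideanSpace ℝ (Fin 3)) (Iio (0 : ℝ)) isOpen_Iio) 1 0 u p ∧ HasWeakSpatialGradientOn (slab (EuclideanSpace ℝ (Fin 3)) (Iio (0 : ℝ)) isOpen_Iio) u G ∧ typeIBound (Iio (0 : ℝ) ×ˢ univ) u p G < ⊤ ∧ HasTypeIDecay C u ∧ IsBackwardSingularPoint u 0) →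
      ∃ (C' : ℝ) (I : ℝ≥0∞) (a b : ℝ) (v : ℕ → ℝ → EuclideanSpace ℝ (Fin 3) → EuclideanSpace ℝ (Fin 3)) (q : ℕ → ℝ → EuclideanSpace ℝ (Fin 3) → ℝ) (H : ℕ → ℝ → EuclideanSpace ℝ (Fin 3) → EuclideanSpace ℝ (Fin 3) →L[ℝ] EuclideanSpace ℝ (Fin 3)),
        I < ⊤ ∧ a < b ∧
        (∀ k : ℕ, IsSuitableWeakSolutionOn (slab (EuclideanSpace ℝ (Fin 3)) (Iio (0 : ℝ)) isOpen_Iio) 1 0 (v k) (q k) ∧ HasWeakSpatialGradientOn (slab (EuclideanSpace ℝ (Fin 3)) (Iio (0 : ℝ)) isOpen_Iio) (v k) (H k) ∧ typeIBound (Iio (0 : ℝ) ×ˢ univ) (v k) (q k) (H k) ≤ I ∧ HasTypeIDecay C' (v k) ∧ IsBackwardSingularPoint (v k) 0) ∧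
        ((0 < a ∧ ∀ lam ∈ Icc a b, ∀ K : Set (EuclideanSpace ℝ (Fin 3)), IsCompact K → (0 : EuclideanSpace ℝ (Fin 3)) ∉ K → ∀ ε : ℝ, 0 < ε → ∀ᶠ k in atTop, ∀ᶠ δ in 𝓝[>] (0 : ℝ), eLpNorm (uncurry (nsRescale lam (v k)) - uncurry (v k)) ⊤ (volume.restrict (Ioo (-δ) 0 ×ˢ K)) ≤ ENNReal.ofReal ε) ∨
         (∀ θ ∈ Icc a b, ∀ K : Set (EuclideanSpace ℝ (Fin 3)), IsCompact K → (0 : EuclideanSpace ℝ (Fin 3)) ∉ K → ∀ ε : ℝ, 0 < ε → ∀ᶠ k in atTop, ∀ᶠ δ in 𝓝[>] (0 : ℝ), eLpNorm (uncurry (conjZ θ (v k)) - uncurry (v k)) ⊤ (volume.restrict (Ioo (-δ) 0 ×ˢ K)) ≤ ENNReal.ofReal ε)) := by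
  intro C hex
  rw [symmetricScarExists_iff_homScar_or_axiScar] at hS
  obtain ⟨C', u, p, G, hsu, hwg, hIu, hdu, hsing, hsym⟩ := hS C hex
  refine ⟨C', typeIBound (Iio (0 : ℝ) ×ˢ univ) u p G, 1, 2, fun _ => u, fun _ => p, fun _ => G, hIu,
    by norm_num, fun _ => ⟨hsu, hwg, le_rfl, hdu, hsing⟩, ?_⟩
  rcases hsym with hhom | hax
  · refine Or.inl ⟨one_pos, fun lam hlam K hK h0 ε hε => Eventually.of_forall fun _ => ?_⟩
    exact eventually_le_ofReal_of_tendsto_zero (hhom lam (one_pos.trans_le hlam.1) K hK h0) hε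
  · refine Or.inr fun θ _ K hK h0 ε hε => Eventually.of_forall fun _ => ?_
    exact eventually_le_ofReal_of_tendsto_zero (hax θ K hK h0) hε

/-- **The bet is an equivalent form of the crux**: `SymmetricScarExists` holds iff every singular apex profile
spawns a sequence of singular apex profiles (bounded `𝐈`, one Type-I constant) with asymptotically scale-flat
(on a window of scales) or rotation-flat (on a window of angles) scars.  The non-trivial direction is the
compactness upgrade `symmetricScarExists_of_flatSource`. [cite: AlbrittonBarker2019, Lemma 2.2 and Prop. 2.3] -/
theorem flatSource_iff_symmetricScarExists :
    (∀ C : ℝ, (∃ (u : ℝ → EuclideanSpace ℝ (Fin 3) → EuclideanSpace ℝ (Fin 3)) (p : ℝ → EuclideanSpace ℝ (Fin 3) → ℝ) (G : ℝ → EuclideanSpace ℝ (Fin 3) → EuclideanSpace ℝ (Fin 3) →L[ℝ] EuclideanSpace ℝ (Fin 3)), IsSuitableWeakSolutionOn (slab (EuclideanSpace ℝ (Fin 3)) (Iio (0 : ℝ)) isOpen_Iio) 1 0 u p ∧ HasWeakSpatialGradientOn (slab (EuclideanSpace ℝ (Fin 3)) (Iio (0 : ℝ)) isOpen_Iio) u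 G ∧ typeIBound (Iio (0 : ℝ) ×ˢ univ) u p G < ⊤ ∧ HasTypeIDecay C u ∧ IsBackwardSingularPoint u 0) →
      ∃ (C' : ℝ) (I : ℝ≥0∞) (a b : ℝ) (v : ℕ → ℝ → EuclideanSpace ℝ (Fin 3) → EuclideanSpace ℝ (Fin 3)) (q : ℕ → ℝ → EuclideanSpace ℝ (Fin 3) → ℝ) (H : ℕ → ℝ → EuclideanSpace ℝ (Fin 3) → EuclideanSpace ℝ (Fin 3) →L[ℝ] EuclideanSpace ℝ (Fin 3)),
        I < ⊤ ∧ a < b ∧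
        (∀ k : ℕ, IsSuitableWeakSolutionOn (slab (EuclideanSpace ℝ (Fin 3)) (Iio (0 : ℝ)) isOpen_Iio) 1 0 (v k) (q k) ∧ HasWeakSpatialGradientOn (slab (EuclideanSpace ℝ (Fin 3)) (Iio (0 : ℝ)) isOpen_Iio) (v k) (H k) ∧ typeIBound (Iio (0 : ℝ) ×ˢ univ) (v k) (q k) (H k) ≤ I ∧ HasTypeIDecay C' (v k) ∧ IsBackwardSingularPoint (v k) 0) ∧
        ((0 < a ∧ ∀ lam ∈ Icc a b, ∀ K : Set (EuclideanSpace ℝ (Fin 3)), IsCompact K → (0 : EuclideanSpace ℝ (Fin 3)) ∉ K → ∀ ε : ℝ, 0 < ε → ∀ᶠ k in atTop, ∀ᶠ δ in 𝓝[>] (0 : ℝ), eLpNorm (uncurry (nsRescale lam (v k)) - uncurry (v k)) ⊤ (volume.restrict (Ioo (-δ) 0 ×ˢ K)) ≤ ENNReal.ofReal ε) ∨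
         (∀ θ ∈ Icc a b, ∀ K : Set (EuclideanSpace ℝ (Fin 3)), IsCompact K → (0 : EuclideanSpace ℝ (Fin 3)) ∉ K → ∀ ε : ℝ, 0 < ε → ∀ᶠ k in atTop, ∀ᶠ δ in 𝓝[>] (0 : ℝ), eLpNorm (uncurry (conjZ θ (v k)) - uncurry (v k)) ⊤ (volume.restrict (Ioo (-δ) 0 ×ˢ K)) ≤ ENNReal.ofReal ε))) ↔
    SymmetricScarExists :=
  ⟨symmetricScarExists_of_flatSource, flatSource_of_symmetricScarExists⟩

/-- **Calibration of the bet** (Disproof §8 for the line): granted the sibling crux `ScarRigidity`, the bet is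
equivalent to the route TARGET `NoApexTypeIProfile` — the three supports `SimilarityCovariance`,
`SelfSimilarApexFatal`, `AxisymmetricApexFatal` of the costume being PROVED tree theorems
(`similarityCovariance_proof`, `rellichScar_selfSimilarApexFatal_proof`, `rellichScar_axisymmetricApexFatal_proof`).
So inside the route's belief system the line carries exactly the difficulty of the target.
[cite: Tsai1998, Thm 2; SereginSverak2009, Thm 3.1] -/
theorem flatSource_iff_noApexTypeIProfile (hSR : ScarRigidity) :
    (∀ C : ℝ, (∃ (u : ℝ → EuclideanSpace ℝ (Fin 3) → EuclideanSpace ℝ (Fin 3)) (p : ℝ → EuclideanSpace ℝ (Fin 3) → ℝ) (G : ℝ → EuclideanSpace ℝ (Fin 3) → EuclideanSpace ℝ (Fin 3) →L[ℝ] EuclideanSpace ℝ (Fin 3)), IsSuitableWeakSolutionOn (slab (EuclideanSpace ℝ (Fin 3)) (Iio (0 : ℝ)) isOpen_Iio) 1 0 u p ∧ HasWeakSpatialGradientOn (slab (EuclideanSpace ℝ (Fin 3)) (Iio (0 : ℝ)) isOpen_Iio) u G ∧ typeIBound (Iio (0 : ℝ) ×ˢ univ) u p G < ⊤ ∧ HasTypeIDecay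 C u ∧ IsBackwardSingularPoint u 0) →
      ∃ (C' : ℝ) (I : ℝ≥0∞) (a b : ℝ) (v : ℕ → ℝ → EuclideanSpace ℝ (Fin 3) → EuclideanSpace ℝ (Fin 3)) (q : ℕ → ℝ → EuclideanSpace ℝ (Fin 3) → ℝ) (H : ℕ → ℝ → EuclideanSpace ℝ (Fin 3) → EuclideanSpace ℝ (Fin 3) →L[ℝ] EuclideanSpace ℝ (Fin 3)),
        I < ⊤ ∧ a < b ∧
        (∀ k : ℕ, IsSuitableWeakSolutionOn (slab (EuclideanSpace ℝ (Fin 3)) (Iio (0 : ℝ)) isOpen_Iio) 1 0 (v k) (q k) ∧ HasWeakSpatialGradientOn (slab (EuclideanSpace ℝ (Fin 3)) (Iio (0 : ℝ)) isOpen_Iio) (v k) (H k) ∧ typeIBound (Iio (0 : ℝ) ×ˢ univ) (v k) (q k) (H k) ≤ I ∧ HasTypeIDecay C' (v k) ∧ IsBackwardSingularPoint (v k) 0) ∧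
        ((0 < a ∧ ∀ lam ∈ Icc a b, ∀ K : Set (EuclideanSpace ℝ (Fin 3)), IsCompact K → (0 : EuclideanSpace ℝ (Fin 3)) ∉ K → ∀ ε : ℝ, 0 < ε → ∀ᶠ k in atTop, ∀ᶠ δ in 𝓝[>] (0 : ℝ), eLpNorm (uncurry (nsRescale lam (v k)) - uncurry (v k)) ⊤ (volume.restrict (Ioo (-δ) 0 ×ˢ K)) ≤ ENNReal.ofReal ε) ∨
         (∀ θ ∈ Icc a b, ∀ K : Set (EuclideanSpace ℝ (Fin 3)), IsCompact K → (0 : EuclideanSpace ℝ (Fin 3)) ∉ K → ∀ ε : ℝ, 0 < ε → ∀ᶠ k in atTop, ∀ᶠ δ in 𝓝[>] (0 : ℝ), eLpNorm (uncurry (conjZ θ (v k)) - uncurry (v k)) ⊤ (volume.restrict (Ioo (-δ) 0 ×ˢ K)) ≤ ENNReal.ofReal ε))) ↔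
    NoApexTypeIProfile :=
  flatSource_iff_symmetricScarExists.trans
    (symmetricScarExists_iff_noApexTypeIProfile hSR
      Summit.NavierStokesRegularity.NavierStokesRegularity.Theorems.RellichScarSimilarityCovariance.similarityCovariance_proof
      Summit.NavierStokesRegularity.NavierStokesRegularity.Theorems.rellichScar_selfSimilarApexFatal_proof
      Summit.NavierStokesRegularity.NavierStokesRegularity.Theorems.rellichScar_axisymmetricApexFatal_proof)

end Summit.NavierStokesRegularity.NavierStokesRegularity.Theorems.SymmetricScarExists.ScarWindow

end
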